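import Summits.QuantumFields.YangMills.Theorems.SwapVirialDeficitZeroModeGroupFourSmallBallDominator
import HarnessLib

/-!
# Exact zero-mode rung, FOUR pairwise nearly commuting letters — VIII-a: the `κ`-cut dominating event (sets, symmetry, fibre strip)
# (zero-mode block of crux ⟨stmt-QuantumFields-24497⟩ `ToronTubeVolumeLaw`; free-hands support of ⟨stmt-QuantumFields-24197⟩ / ⟨24497⟩)

Toward the UNIFORM DECAY `vol³(T(η, ζ, κ)) ≤ C·κ^{-1/4}` (all `η, ζ ≥ 0`; part VIII-b) — the estimate that cuts the logarithm of `N₄` off at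
`‖Im a‖ ≈ √t` and bounds the deep region `‖Im a‖ ≲ t`.  The pair constraints of `T` force `κ·(p_x × p_y)² ≤ 1`; this file adds that cut to the
majorant of parts IV-a/b/c:
* §26 `crossSq x y = (x_Jy_K − x_Ky_J)²`, ★ `domSetK κ = domSet4 ∩ {κ·crossSq ≤ 1 pairwise} ⊇ T(η, ζ, κ)`, the reference split `domRefK`,
  `vol³(domSetK κ) ≤ 3·vol³(domRefK κ)` (letter permutations ✓`swapXY`/✓`swapXZ`);
* §27 the cut fibre `fibreK κ x = fibre4 x ∩ {κ·crossSq x z ≤ 1}` and its THIRD volume bound ★ `volume_fibreK_le_kappa :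
  vol(fibreK κ x) ≤ 16√2/(√(tvSq x)·√κ)` (the cut is a strip of width `2√2/(√(tvSq x)√κ)` in the larger transverse coordinate), next to the two
  bounds inherited from ✓`fibre4` (`16√(tvSq x)`, `16√2/|x_I|`).
HONEST LABEL: finite-dimensional measure theory on `SU(2)⁴` (plan-level zero-mode rung of DRAFT lines); NOT ⟨24497⟩, NOT ⟨24197⟩; the Yang–Mills mass gap
is NOT proved; no summit is proved by a line.  Seat ym-line-fcl-p3 g44 (cell ym-idea-1, free hands), `--supports stmt-QuantumFields-24197`.  Standard axioms
(auxiliary defs `crossSq`, `domSetK`, `domRefK`, `fibreK`, `PsetK`, `fibreBoxK`).  References: [cite: GonzalezarroyoAltes1988]; [cite: Vanbaal2001]; [folklore].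
-/

set_option autoImplicit false

noncomputable section

open MeasureTheory Quaternion Set Real
open scoped Quaternion ENNReal BigOperators
open Literature.MathematicalPhysics.QuantumLattice
open Summit.QuantumFields.YangMills.Theorems.SwapTwistDeficit.ToronLog

attribute [local instance] Literature.Analysis.FluidPDE.Tao2016.quatMeasurableSpace
  Literature.Analysis.FluidPDE.Tao2016.quatBorelSpace
  Literature.MathematicalPhysics.QuantumLattice.secondCountableTopology_su2

namespace Summit.QuantumFields.YangMills.Theorems.SwapVirialDeficit.ZeroModeGroup

/-! ## §26 The `κ`-cut dominating event and its reference split -/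

/-- The squared cross product of the transverse parts `(p_x × p_y)² = (x_Jy_K − x_Ky_J)²`. [folklore] -/
def crossSq (x y : ℍ) : ℝ := (x.imJ * y.imK - x.imK * y.imJ) ^ 2

/-- Unfolding `crossSq`. [folklore] -/
theorem crossSq_def (x y : ℍ) : crossSq x y = (x.imJ * y.imK - x.imK * y.imJ) ^ 2 := rfl

/-- `crossSq` is symmetric. [folklore] -/
theorem crossSq_comm (x y : ℍ) : crossSq x y = crossSq y x := by unfold crossSq; ring

/-- `crossSq` is jointly continuous. [folklore] -/
theorem continuous_crossSq : Continuous fun p : ℍ × ℍ => crossSq p.1 p.2 := by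
  unfold crossSq
  have hJ1 : Continuous fun p : ℍ × ℍ => p.1.imJ := Quaternion.continuous_imJ.comp continuous_fst
  have hK1 : Continuous fun p : ℍ × ℍ => p.1.imK := Quaternion.continuous_imK.comp continuous_fst
  have hJ2 : Continuous fun p : ℍ × ℍ => p.2.imJ := Quaternion.continuous_imJ.comp continuous_snd
  have hK2 : Continuous fun p : ℍ × ℍ => p.2.imK := Quaternion.continuous_imK.comp continuous_snd
  exact ((hJ1.mul hK2).sub (hK1.mul hJ2)).pow 2

/-- `{w | κ·crossSq (f w) (g w) ≤ 1}` is measurable. [folklore] -/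
theorem measurableSet_crossSq_le {α : Type*} [MeasurableSpace α] {f g : α → ℍ} (hf : Measurable f) (hg : Measurable g) (κ : ℝ) :
    MeasurableSet {w | κ * crossSq (f w) (g w) ≤ 1} :=
  measurableSet_le ((continuous_crossSq.measurable.comp (hf.prodMk hg)).const_mul κ) measurable_const

/-- ★ **The `κ`-cut dominating event** `U_κ = U ∩ {κ(p_x × p_y)² ≤ 1, κ(p_x × p_z)² ≤ 1, κ(p_y × p_z)² ≤ 1}`. [folklore] -/
def domSetK (κ : ℝ) : Set ((ℍ × ℍ) × ℍ) :=
  {w | w ∈ domSet4 ∧ κ * crossSq w.1.1 w.1.2 ≤ 1 ∧ κ * crossSq w.1.1 w.2 ≤ 1 ∧ κ * crossSq w.1.2 w.2 ≤ 1}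

/-- One pair: `P + κC² ≤ M(x)M(y)` with `P ≥ 0`, `M(x) < 1`, `M(y) ∈ [0,1)` forces `κC² ≤ 1`. [folklore] -/
theorem kappa_crossSq_le_one_of {κ Mx My C P : ℝ} (hP : 0 ≤ P) (hMx1 : Mx < 1) (hMy0 : 0 ≤ My) (hMy1 : My < 1)
    (h : P + κ * C ^ 2 ≤ Mx * My) : κ * C ^ 2 ≤ 1 := by
  nlinarith [mul_le_one₀ hMx1.le hMy0 hMy1.le]

/-- ★ `T(η, ζ, κ) ⊆ U_κ` for all `η, ζ ≥ 0` (any `κ`). [folklore] -/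
theorem twoScaleSet4_subset_domSetK {η ζ : ℝ} (hη : 0 ≤ η) (hζ : 0 ≤ ζ) {κ : ℝ} (hκ : 0 ≤ κ) : twoScaleSet4 η ζ κ ⊆ domSetK κ := by
  intro w hw
  refine ⟨twoScaleSet4_subset_domSet4 hη hζ hκ hw, ?_⟩
  obtain ⟨⟨x, y⟩, z⟩ := w
  simp only [twoScaleSet4, Set.mem_setOf_eq] at hw
  obtain ⟨h1, h2, h3, -, -, -, h7, h8, h9⟩ := hw
  have hy0 := tsNorm_nonneg hη hζ y; have hz0 := tsNorm_nonneg hη hζ z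
  simp only [crossSq]
  exact ⟨kappa_crossSq_le_one_of (by positivity) h1 hy0 h2 h7, kappa_crossSq_le_one_of (by positivity) h1 hz0 h3 h8,
    kappa_crossSq_le_one_of (by positivity) h2 hz0 h3 h9⟩

/-- `U_κ` is measurable. [folklore] -/
theorem measurableSet_domSetK (κ : ℝ) : MeasurableSet (domSetK κ) := by
  obtain ⟨hx, hy, hz⟩ := measurable_letters
  unfold domSetK
  exact measurableSet_domSet4.inter ((measurableSet_crossSq_le hx hy κ).inter ((measurableSet_crossSq_le hx hz κ).inter
    (measurableSet_crossSq_le hy hz κ)))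

/-- The part of `U_κ` where the first letter has the largest transverse size. [folklore] -/
def domRefK (κ : ℝ) : Set ((ℍ × ℍ) × ℍ) := {w | w ∈ domSetK κ ∧ tvSq w.1.2 ≤ tvSq w.1.1 ∧ tvSq w.2 ≤ tvSq w.1.1}

/-- `domRefK κ` is measurable. [folklore] -/
theorem measurableSet_domRefK (κ : ℝ) : MeasurableSet (domRefK κ) := by
  obtain ⟨hx, hy, hz⟩ := measurable_letters
  unfold domRefK
  exact (measurableSet_domSetK κ).inter ((measurableSet_tvSq_le hy (continuous_tvSq.measurable.comp hx)).inter
    (measurableSet_tvSq_le hz (continuous_tvSq.measurable.comp hx)))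

/-- `U_κ` is symmetric under `swapXY`. [folklore] -/
theorem swapXY_mem_domSetK {κ : ℝ} {w : (ℍ × ℍ) × ℍ} (hw : w ∈ domSetK κ) : swapXY w ∈ domSetK κ := by
  obtain ⟨h0, h1, h2, h3⟩ := hw
  refine ⟨swapXY_mem_domSet4 h0, ?_, ?_, ?_⟩
  · show κ * crossSq w.1.2 w.1.1 ≤ 1; rwa [crossSq_comm]
  · exact h3
  · exact h2

/-- `U_κ` is symmetric under `swapXZ`. [folklore] -/
theorem swapXZ_mem_domSetK {κ : ℝ} {w : (ℍ × ℍ) × ℍ} (hw : w ∈ domSetK κ) : swapXZ w ∈ domSetK κ := by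
  obtain ⟨h0, h1, h2, h3⟩ := hw
  refine ⟨swapXZ_mem_domSet4 h0, ?_, ?_, ?_⟩
  · show κ * crossSq w.2 w.1.2 ≤ 1; rwa [crossSq_comm]
  · show κ * crossSq w.2 w.1.1 ≤ 1; rwa [crossSq_comm]
  · show κ * crossSq w.1.2 w.1.1 ≤ 1; rwa [crossSq_comm]

/-- Some letter has the largest transverse size: `U_κ ⊆ domRefK ∪ swapXY⁻¹ domRefK ∪ swapXZ⁻¹ domRefK`. [folklore] -/
theorem domSetK_subset_union (κ : ℝ) : domSetK κ ⊆ domRefK κ ∪ (swapXY ⁻¹' domRefK κ ∪ swapXZ ⁻¹' domRefK κ) := by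
  intro w hw
  by_cases hxy : tvSq w.1.2 ≤ tvSq w.1.1
  · by_cases hxz : tvSq w.2 ≤ tvSq w.1.1
    · exact Or.inl ⟨hw, hxy, hxz⟩
    · right; right
      refine ⟨swapXZ_mem_domSetK hw, ?_, ?_⟩
      · show tvSq w.1.2 ≤ tvSq w.2; linarith [not_le.1 hxz]
      · show tvSq w.1.1 ≤ tvSq w.2; linarith [not_le.1 hxz]
  · by_cases hyz : tvSq w.2 ≤ tvSq w.1.2
    · right; left
      refine ⟨swapXY_mem_domSetK hw, ?_, ?_⟩
      · show tvSq w.1.1 ≤ tvSq w.1.2; linarith [not_le.1 hxy]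
      · show tvSq w.2 ≤ tvSq w.1.2; exact hyz
    · right; right
      refine ⟨swapXZ_mem_domSetK hw, ?_, ?_⟩
      · show tvSq w.1.2 ≤ tvSq w.2; linarith [not_le.1 hyz]
      · show tvSq w.1.1 ≤ tvSq w.2; linarith [not_le.1 hxy, not_le.1 hyz]

/-- ★ **Reduction to the reference letter**: `vol³(U_κ) ≤ vol³(domRefK κ) + vol³(domRefK κ) + vol³(domRefK κ)`. [folklore] -/
theorem volume_domSetK_le (κ : ℝ) :
    (((volume : Measure ℍ).prod (volume : Measure ℍ)).prod (volume : Measure ℍ)) (domSetK κ) ≤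
      (((volume : Measure ℍ).prod (volume : Measure ℍ)).prod (volume : Measure ℍ)) (domRefK κ) +
      (((volume : Measure ℍ).prod (volume : Measure ℍ)).prod (volume : Measure ℍ)) (domRefK κ) +
      (((volume : Measure ℍ).prod (volume : Measure ℍ)).prod (volume : Measure ℍ)) (domRefK κ) := by
  have h1 := measurePreserving_swapXY.measure_preimage (measurableSet_domRefK κ).nullMeasurableSet
  have h2 := measurePreserving_swapXZ.measure_preimage (measurableSet_domRefK κ).nullMeasurableSet
  calc (((volume : Measure ℍ).prod (volume : Measure ℍ)).prod (volume : Measure ℍ)) (domSetK κ)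
      ≤ (((volume : Measure ℍ).prod (volume : Measure ℍ)).prod (volume : Measure ℍ)) (domRefK κ ∪ (swapXY ⁻¹' domRefK κ ∪ swapXZ ⁻¹' domRefK κ)) :=
        measure_mono (domSetK_subset_union κ)
    _ ≤ (((volume : Measure ℍ).prod (volume : Measure ℍ)).prod (volume : Measure ℍ)) (domRefK κ) +
          ((((volume : Measure ℍ).prod (volume : Measure ℍ)).prod (volume : Measure ℍ)) (swapXY ⁻¹' domRefK κ) +
            (((volume : Measure ℍ).prod (volume : Measure ℍ)).prod (volume : Measure ℍ)) (swapXZ ⁻¹' domRefK κ)) :=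
        (measure_union_le _ _).trans (add_le_add le_rfl (measure_union_le _ _))
    _ = _ := by rw [h1, h2, add_assoc]

/-! ## §27 The cut fibre and its strip bound -/

/-- The cut fibre of a non-reference letter: `fibre4 x ∩ {κ·(p_x × p_z)² ≤ 1}`. [folklore] -/
def fibreK (κ : ℝ) (x : ℍ) : Set ℍ := {z | z ∈ fibre4 x ∧ κ * crossSq x z ≤ 1}

/-- `fibreK κ x ⊆ fibre4 x`. [folklore] -/
theorem fibreK_subset_fibre4 (κ : ℝ) (x : ℍ) : fibreK κ x ⊆ fibre4 x := fun _ hz => hz.1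

/-- `fibreK κ x` is measurable. [folklore] -/
theorem measurableSet_fibreK (κ : ℝ) (x : ℍ) : MeasurableSet (fibreK κ x) := by
  unfold fibreK
  exact (measurableSet_fibre4 x).inter (measurableSet_crossSq_le measurable_const measurable_id κ)

/-- The cut fibre is jointly measurable in `(x, z)`. [folklore] -/
theorem measurableSet_fibreK_joint (κ : ℝ) : MeasurableSet {q : ℍ × ℍ | q.2 ∈ fibreK κ q.1} := by
  simp only [fibreK, Set.mem_setOf_eq]
  exact measurableSet_fibre4_joint.inter (measurableSet_crossSq_le measurable_fst measurable_snd κ)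

/-- **Sections of `domRefK`**: over `(x, y)` the `z`-section lies in `fibreK κ x`, and is empty unless `x ∈ okRef` and `y ∈ fibreK κ x`. [folklore] -/
theorem section_domRefK {κ : ℝ} {x y z : ℍ} (h : ((x, y), z) ∈ domRefK κ) : x ∈ okRef ∧ y ∈ fibreK κ x ∧ z ∈ fibreK κ x := by
  obtain ⟨⟨hU, c1, c2, -⟩, hyx, hzx⟩ := h
  obtain ⟨hx, hy, hz⟩ := section_domRef (show ((x, y), z) ∈ domRef from ⟨hU, hyx, hzx⟩)
  exact ⟨hx, ⟨hy, c1⟩, ⟨hz, c2⟩⟩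

/-- The cut transverse set: `Pset x ∩ {κ(x_J q₂ − x_K q₁)² ≤ 1}`. [folklore] -/
def PsetK (κ : ℝ) (x : ℍ) : Set (ℝ × ℝ) := {q | q ∈ Pset x ∧ κ * (x.imJ * q.2 - x.imK * q.1) ^ 2 ≤ 1}

/-- `PsetK κ x` is measurable. [folklore] -/
theorem measurableSet_PsetK (κ : ℝ) (x : ℍ) : MeasurableSet (PsetK κ x) := by
  have h3 : Measurable fun q : ℝ × ℝ => κ * (x.imJ * q.2 - x.imK * q.1) ^ 2 :=
    (((measurable_snd.const_mul _).sub (measurable_fst.const_mul _)).pow_const 2).const_mul _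
  unfold PsetK
  exact (measurableSet_Pset x).inter (measurableSet_le h3 measurable_const)

/-- ★ **The strip bound**: `area(PsetK κ x) ≤ 4√2/√κ` (`κ > 0`, `tvSq x > 0`): in the larger of the two coordinates of `(x_J, x_K)` the cut is a
strip of width `≤ 2√2/(√(tvSq x)·√κ)`, the other coordinate ranges over `[−√(tvSq x), √(tvSq x)]`. [folklore] -/
theorem volume_PsetK_le {κ : ℝ} (hκ : 0 < κ) {x : ℍ} (hpos : 0 < tvSq x) :
    volume (PsetK κ x) ≤ ENNReal.ofReal (4 * Real.sqrt 2 / Real.sqrt κ) := by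
  set ρ2 := tvSq x with hρ2
  have hsκ : 0 < Real.sqrt κ := Real.sqrt_pos.2 hκ
  have hsρ : 0 < Real.sqrt ρ2 := Real.sqrt_pos.2 hpos
  have hIcc : volume (Icc (-Real.sqrt ρ2) (Real.sqrt ρ2)) = ENNReal.ofReal (2 * Real.sqrt ρ2) := by rw [Real.volume_Icc]; congr 1; ring
  -- the strip `{v | κ (a v − b)² ≤ 1}` has length `2/(√κ |a|) ≤ 2√2/(√κ √ρ2)` when `ρ2 ≤ 2a²`
  have hstrip : ∀ {a : ℝ} (b : ℝ), a ≠ 0 → ρ2 ≤ 2 * a ^ 2 →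
      volume {v : ℝ | κ * (a * v - b) ^ 2 ≤ 1} ≤ ENNReal.ofReal (2 * Real.sqrt 2 / (Real.sqrt κ * Real.sqrt ρ2)) := by
    intro a b ha ha2
    have e : {v : ℝ | κ * (a * v - b) ^ 2 ≤ 1} = {v : ℝ | Real.sqrt κ ^ 2 * (a * v - b) ^ 2 ≤ 1} := by rw [Real.sq_sqrt hκ.le]
    rw [e]
    refine (volume_strip_le hsκ.ne' ha b 1).trans (ENNReal.ofReal_le_ofReal ?_)
    rw [Real.sqrt_one, abs_of_pos hsκ]
    have hapos : 0 < |a| := abs_pos.2 ha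
    have hs : Real.sqrt ρ2 ≤ Real.sqrt 2 * |a| := by
      rw [← Real.sqrt_sq_eq_abs, ← Real.sqrt_mul (by norm_num : (0:ℝ) ≤ 2)]; exact Real.sqrt_le_sqrt (by linarith)
    rw [div_le_div_iff₀ (mul_pos hsκ hapos) (mul_pos hsκ hsρ)]
    calc 2 * 1 * (Real.sqrt κ * Real.sqrt ρ2) ≤ 2 * (Real.sqrt κ * (Real.sqrt 2 * |a|)) := by nlinarith [hsκ.le]
      _ = 2 * Real.sqrt 2 * (Real.sqrt κ * |a|) := by ring
  have hfin : ENNReal.ofReal (2 * Real.sqrt 2 / (Real.sqrt κ * Real.sqrt ρ2)) * ENNReal.ofReal (2 * Real.sqrt ρ2) =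
      ENNReal.ofReal (4 * Real.sqrt 2 / Real.sqrt κ) := by
    rw [← ENNReal.ofReal_mul (by positivity)]; congr 1; field_simp; ring
  by_cases hJK : x.imK ^ 2 ≤ x.imJ ^ 2
  · have hJ : x.imJ ≠ 0 := by
      intro h; rw [h] at hJK; have : tvSq x = 0 := by unfold tvSq; nlinarith [sq_nonneg x.imK]
      linarith
    have hJ2 : ρ2 ≤ 2 * x.imJ ^ 2 := by rw [hρ2, tvSq]; linarith
    rw [Measure.volume_eq_prod, Measure.prod_apply (measurableSet_PsetK κ x)]
    have hsec : ∀ u : ℝ, volume (Prod.mk u ⁻¹' PsetK κ x) ≤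
        (Icc (-Real.sqrt ρ2) (Real.sqrt ρ2)).indicator (fun _ => ENNReal.ofReal (2 * Real.sqrt 2 / (Real.sqrt κ * Real.sqrt ρ2))) u := by
      intro u
      by_cases hu : u ∈ Icc (-Real.sqrt ρ2) (Real.sqrt ρ2)
      · rw [Set.indicator_of_mem hu]
        have hsub : Prod.mk u ⁻¹' PsetK κ x ⊆ {v : ℝ | κ * (x.imJ * v - x.imK * u) ^ 2 ≤ 1} := fun v hv => hv.2
        exact (measure_mono hsub).trans (hstrip (x.imK * u) hJ hJ2)
      · rw [Set.indicator_of_notMem hu]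
        have hemp : Prod.mk u ⁻¹' PsetK κ x = ∅ := by
          ext v; simp only [Set.mem_preimage, Set.mem_empty_iff_false, iff_false]
          intro hv; exact hu (mem_Icc_of_sq_le hv.1.1)
        rw [hemp, measure_empty]
    calc ∫⁻ u, volume (Prod.mk u ⁻¹' PsetK κ x) ≤ ∫⁻ u, (Icc (-Real.sqrt ρ2) (Real.sqrt ρ2)).indicator
          (fun _ => ENNReal.ofReal (2 * Real.sqrt 2 / (Real.sqrt κ * Real.sqrt ρ2))) u := lintegral_mono hsec
      _ = _ := by rw [lintegral_indicator measurableSet_Icc, setLIntegral_const, hIcc, hfin]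
  · have hKJ : x.imJ ^ 2 ≤ x.imK ^ 2 := (not_le.1 hJK).le
    have hK : x.imK ≠ 0 := by
      intro h; rw [h] at hKJ; have : tvSq x = 0 := by unfold tvSq; nlinarith [sq_nonneg x.imJ]
      linarith
    have hK2 : ρ2 ≤ 2 * x.imK ^ 2 := by rw [hρ2, tvSq]; linarith
    rw [Measure.volume_eq_prod, Measure.prod_apply_symm (measurableSet_PsetK κ x)]
    have hsec : ∀ v : ℝ, volume ((fun u => (u, v)) ⁻¹' PsetK κ x) ≤
        (Icc (-Real.sqrt ρ2) (Real.sqrt ρ2)).indicator (fun _ => ENNReal.ofReal (2 * Real.sqrt 2 / (Real.sqrt κ * Real.sqrt ρ2))) v := by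
      intro v
      by_cases hv : v ∈ Icc (-Real.sqrt ρ2) (Real.sqrt ρ2)
      · rw [Set.indicator_of_mem hv]
        have hsub : (fun u => (u, v)) ⁻¹' PsetK κ x ⊆ {u : ℝ | κ * (x.imK * u - x.imJ * v) ^ 2 ≤ 1} := by
          intro u hu
          have h3 := hu.2
          simp only [Set.mem_setOf_eq]
          have e : (x.imK * u - x.imJ * v) ^ 2 = (x.imJ * v - x.imK * u) ^ 2 := by ring
          rw [e]; exact h3
        exact (measure_mono hsub).trans (hstrip (x.imJ * v) hK hK2)
      · rw [Set.indicator_of_notMem hv]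
        have hemp : (fun u => (u, v)) ⁻¹' PsetK κ x = ∅ := by
          ext u; simp only [Set.mem_preimage, Set.mem_empty_iff_false, iff_false]
          intro hu; exact hv (mem_Icc_of_sq_le hu.1.2.1)
        rw [hemp, measure_empty]
    calc ∫⁻ v, volume ((fun u => (u, v)) ⁻¹' PsetK κ x) ≤ ∫⁻ v, (Icc (-Real.sqrt ρ2) (Real.sqrt ρ2)).indicator
          (fun _ => ENNReal.ofReal (2 * Real.sqrt 2 / (Real.sqrt κ * Real.sqrt ρ2))) v := lintegral_mono hsec
      _ = _ := by rw [lintegral_indicator measurableSet_Icc, setLIntegral_const, hIcc, hfin]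

/-- The coordinate box of the cut fibre. [folklore] -/
def fibreBoxK (κ : ℝ) (x : ℍ) : Set (ℝ × (ℝ × (ℝ × ℝ))) :=
  Ioo (-1 : ℝ) 1 ×ˢ {q : ℝ × (ℝ × ℝ) | q.2 ∈ PsetK κ x ∧ cI x q.2 - 1 / Real.sqrt (tvSq x) ≤ q.1 ∧ q.1 ≤ cI x q.2 + 1 / Real.sqrt (tvSq x)}

/-- The second factor of `fibreBoxK` is measurable. [folklore] -/
theorem measurableSet_fibreBoxK_snd (κ : ℝ) (x : ℍ) :
    MeasurableSet {q : ℝ × (ℝ × ℝ) | q.2 ∈ PsetK κ x ∧ cI x q.2 - 1 / Real.sqrt (tvSq x) ≤ q.1 ∧ q.1 ≤ cI x q.2 + 1 / Real.sqrt (tvSq x)} := by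
  have hc : Measurable fun q : ℝ × (ℝ × ℝ) => cI x q.2 := (continuous_cI x).measurable.comp measurable_snd
  exact (measurable_snd (measurableSet_PsetK κ x)).inter ((measurableSet_le (hc.sub measurable_const) measurable_fst).inter
    (measurableSet_le measurable_fst (hc.add measurable_const)))

/-- The cut fibre lies in its coordinate box (`tvSq x > 0`). [folklore] -/
theorem fibreK_subset_preimage_fibreBoxK {κ : ℝ} {x : ℍ} (hρ : 0 < tvSq x) : fibreK κ x ⊆ coord4 ⁻¹' fibreBoxK κ x := by
  intro z hz
  obtain ⟨hz4, hcut⟩ := hz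
  have hb := fibre4_subset_preimage_fibreBox hρ hz4
  obtain ⟨h1, ⟨hP, h2, h3⟩⟩ := hb
  exact ⟨h1, ⟨⟨hP, hcut⟩, h2, h3⟩⟩

/-- `vol(fibreK κ x) ≤ 2·(2/ρ)·area(PsetK κ x)` (`ρ² = tvSq x > 0`). [folklore] -/
theorem volume_fibreK_le_of_PsetK {κ : ℝ} {x : ℍ} (hρ : 0 < tvSq x) :
    volume (fibreK κ x) ≤ ENNReal.ofReal 2 * (ENNReal.ofReal (2 / Real.sqrt (tvSq x)) * volume (PsetK κ x)) := by
  have hS := measurableSet_fibreBoxK_snd κ x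
  have hbox : MeasurableSet (fibreBoxK κ x) := measurableSet_Ioo.prod hS
  have h1 : volume (fibreK κ x) ≤ volume (coord4 ⁻¹' fibreBoxK κ x) := measure_mono (fibreK_subset_preimage_fibreBoxK hρ)
  rw [measurePreserving_coord4.measure_preimage hbox.nullMeasurableSet] at h1
  refine h1.trans ?_
  rw [fibreBoxK, Measure.volume_eq_prod, Measure.prod_prod, Real.volume_Ioo, show (1 : ℝ) - -1 = 2 by norm_num]
  gcongr
  rw [Measure.volume_eq_prod, Measure.prod_apply_symm hS]
  have hsec : ∀ q : ℝ × ℝ, volume ((fun u : ℝ => (u, q)) ⁻¹'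
      {q : ℝ × (ℝ × ℝ) | q.2 ∈ PsetK κ x ∧ cI x q.2 - 1 / Real.sqrt (tvSq x) ≤ q.1 ∧ q.1 ≤ cI x q.2 + 1 / Real.sqrt (tvSq x)}) ≤
      (PsetK κ x).indicator (fun _ => ENNReal.ofReal (2 / Real.sqrt (tvSq x))) q := by
    intro q
    by_cases hq : q ∈ PsetK κ x
    · rw [Set.indicator_of_mem hq]
      have hsub : (fun u : ℝ => (u, q)) ⁻¹'
          {q : ℝ × (ℝ × ℝ) | q.2 ∈ PsetK κ x ∧ cI x q.2 - 1 / Real.sqrt (tvSq x) ≤ q.1 ∧ q.1 ≤ cI x q.2 + 1 / Real.sqrt (tvSq x)} ⊆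
          Icc (cI x q - 1 / Real.sqrt (tvSq x)) (cI x q + 1 / Real.sqrt (tvSq x)) := fun u hu => ⟨hu.2.1, hu.2.2⟩
      refine (measure_mono hsub).trans ?_
      rw [Real.volume_Icc]; apply le_of_eq; congr 1; ring
    · rw [Set.indicator_of_notMem hq]
      have hemp : (fun u : ℝ => (u, q)) ⁻¹'
          {q : ℝ × (ℝ × ℝ) | q.2 ∈ PsetK κ x ∧ cI x q.2 - 1 / Real.sqrt (tvSq x) ≤ q.1 ∧ q.1 ≤ cI x q.2 + 1 / Real.sqrt (tvSq x)} = ∅ := by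
        ext u; simp only [Set.mem_preimage, Set.mem_setOf_eq, Set.mem_empty_iff_false, iff_false, not_and]
        intro h; exact absurd h hq
      rw [hemp, measure_empty]
  calc _ ≤ ∫⁻ q, (PsetK κ x).indicator (fun _ => ENNReal.ofReal (2 / Real.sqrt (tvSq x))) q := lintegral_mono hsec
    _ = _ := by rw [lintegral_indicator (measurableSet_PsetK κ x), setLIntegral_const]

/-- ★ **Third fibre bound**: `vol(fibreK κ x) ≤ 16√2/(√(tvSq x)·√κ)` (`κ > 0`; trivially true when `tvSq x = 0`, the fibre being null). [folklore] -/
theorem volume_fibreK_le_kappa {κ : ℝ} (hκ : 0 < κ) {x : ℍ} (hpos : 0 < tvSq x) :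
    volume (fibreK κ x) ≤ ENNReal.ofReal (16 * Real.sqrt 2 / (Real.sqrt (tvSq x) * Real.sqrt κ)) := by
  have hs : 0 < Real.sqrt (tvSq x) := Real.sqrt_pos.2 hpos
  have hk : 0 < Real.sqrt κ := Real.sqrt_pos.2 hκ
  refine (volume_fibreK_le_of_PsetK hpos).trans ?_
  calc ENNReal.ofReal 2 * (ENNReal.ofReal (2 / Real.sqrt (tvSq x)) * volume (PsetK κ x))
      ≤ ENNReal.ofReal 2 * (ENNReal.ofReal (2 / Real.sqrt (tvSq x)) * ENNReal.ofReal (4 * Real.sqrt 2 / Real.sqrt κ)) := by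
        gcongr; exact volume_PsetK_le hκ hpos
    _ = ENNReal.ofReal (16 * Real.sqrt 2 / (Real.sqrt (tvSq x) * Real.sqrt κ)) := by
        rw [← ENNReal.ofReal_mul (by positivity), ← ENNReal.ofReal_mul (by positivity)]
        congr 1
        field_simp
        ring

/-- `vol(fibreK κ x) ≤ Gb x` (inherited from ✓`fibre4`). [folklore] -/
theorem volume_fibreK_le_Gb (κ : ℝ) (x : ℍ) : volume (fibreK κ x) ≤ Gb x :=
  (measure_mono (fibreK_subset_fibre4 κ x)).trans (volume_fibre4_le_Gb x)

end Summit.QuantumFields.YangMills.Theorems.SwapVirialDeficit.ZeroModeGroup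

end
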